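import Literature.NumberTheory.Sieve.CoprimeMoebiusLogSums
import Mathlib.Analysis.SpecialFunctions.Pow.Deriv
import Mathlib.MeasureTheory.Integral.IntervalIntegral.FundThmCalculus
import HarnessLib

/-!
# The coprime Möbius log sum twisted by `g^{-δ}`

Topic `Literature/NumberTheory/Sieve`. Everything here is PROVED. For `q ≥ 1`, `0 ≤ δ` and
`y ≥ 1`,

  `|Σ_{g ≤ y, (g,q)=1} μ(g) g^{-1-δ} log(y/g)| ≤ (q/φ(q) + 6)(1 + δ log y)`

(`abs_sum_coprime_moebius_rpow_log_le`), deduced from the tree's untwisted bound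
`|Σ_{g ≤ T, (g,q)=1} μ(g)/g · log(T/g)| ≤ q/φ(q) + 6` for all real `T`
(`CoprimeMoebius.abs_sum_coprime_moebius_div_mul_log_le`) by one Abel summation: with
`ψ(T) = T^{-δ}(1 + δ log(y/T))` one has, for `1 ≤ g ≤ y`,
`g^{-δ} log(y/g) = ψ(y) log(y/g) + ∫_g^y (−ψ'(T)) log(T/g) dT` (an antiderivative of the
integrand is `−ψ(T) log(T/g) − T^{-δ} log(y/T)`), so the twisted sum equals
`ψ(y) M(y) + ∫_1^y (−ψ'(T)) M(T) dT` with `M(T)` the untwisted sum at `T`; since `−ψ' ≥ 0` on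
`[1, y]` the bound is `(q/φ(q)+6)(ψ(y) + ψ(1) − ψ(y)) = (q/φ(q)+6)(1 + δ log y)`. This is the input
for the Selberg diagonalisation of the two-level Graham weights at the point `1 + δ`
(Motohashi's device for the sieve side of the log-free zero-density estimate).

## References
* S. W. Graham, *An asymptotic estimate related to Selberg's sieve*, J. Number Theory 10 (1978),
  Lemma 2. [folklore]
* Y. Motohashi, *Sieve Methods and Prime Number Theory* (Tata LN 72, 1983), §1.3. [folklore]
-/

noncomputable section

open Finset Real MeasureTheory intervalIntegral

open scoped ArithmeticFunction.Moebius

namespace Literature.NumberTheory.Sieve.CoprimeMoebius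

/-! ### The test function of the Abel summation -/

/-- `ψ(T) = T^{-δ}(1 + δ log(y/T))`. [folklore] -/
def psiW (δ y T : ℝ) : ℝ := T ^ (-δ) * (1 + δ * Real.log (y / T))

/-- `ψ'(T) = −δ T^{-1-δ}(2 + δ log(y/T))`. [folklore] -/
def psiW' (δ y T : ℝ) : ℝ := -δ * T ^ (-1 - δ) * (2 + δ * Real.log (y / T))

/-- `ψ(y) = y^{-δ}`. [folklore] -/
theorem psiW_self (δ : ℝ) {y : ℝ} (hy : 0 < y) : psiW δ y y = y ^ (-δ) := by
  simp [psiW, div_self hy.ne']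

/-- `ψ(1) = 1 + δ log y`. [folklore] -/
theorem psiW_one (δ y : ℝ) : psiW δ y 1 = 1 + δ * Real.log y := by
  simp [psiW]

/-- `0 ≤ ψ(y)`. [folklore] -/
theorem psiW_self_nonneg (δ : ℝ) {y : ℝ} (hy : 0 < y) : 0 ≤ psiW δ y y := by
  rw [psiW_self δ hy]; positivity

/-- `d/dT log(y/T) = −1/T` for `T, y > 0`. [folklore] -/
theorem hasDerivAt_log_div {y T : ℝ} (hy : 0 < y) (hT : 0 < T) :
    HasDerivAt (fun T : ℝ => Real.log (y / T)) (-1 / T) T := by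
  have : HasDerivAt (fun T : ℝ => Real.log y - Real.log T) (0 - T⁻¹) T :=
    (hasDerivAt_const T _).sub (Real.hasDerivAt_log hT.ne')
  have heq : (fun T : ℝ => Real.log (y / T)) =ᶠ[nhds T] fun T => Real.log y - Real.log T := by
    filter_upwards [lt_mem_nhds hT] with u hu
    rw [Real.log_div hy.ne' hu.ne']
  rw [show (-1 / T : ℝ) = 0 - T⁻¹ by ring]
  exact this.congr_of_eventuallyEq heq

/-- `d/dT T^{-δ} = −δ T^{-1-δ}` for `T > 0`. [folklore] -/
theorem hasDerivAt_rpow_neg' (δ : ℝ) {T : ℝ} (hT : 0 < T) :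
    HasDerivAt (fun T : ℝ => T ^ (-δ)) (-δ * T ^ (-1 - δ)) T := by
  have h := (hasDerivAt_id T).rpow_const (p := -δ) (Or.inl hT.ne')
  simp only [id, one_mul] at h
  rwa [show (-δ - 1 : ℝ) = -1 - δ by ring] at h

/-- `HasDerivAt ψ ψ'` at `T > 0` (`y > 0`). [folklore] -/
theorem hasDerivAt_psiW (δ : ℝ) {y T : ℝ} (hy : 0 < y) (hT : 0 < T) :
    HasDerivAt (psiW δ y) (psiW' δ y T) T := by
  have h1 := hasDerivAt_rpow_neg' δ hT
  have h2 : HasDerivAt (fun T : ℝ => 1 + δ * Real.log (y / T)) (δ * (-1 / T)) T := by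
    simpa using ((hasDerivAt_log_div hy hT).const_mul δ).const_add 1
  have h := h1.mul h2
  have hT1 : T ^ (-δ) = T ^ (-1 - δ) * T := by
    rw [show (-δ : ℝ) = (-1 - δ) + 1 by ring, Real.rpow_add hT, Real.rpow_one]
  have heq : -δ * T ^ (-1 - δ) * (1 + δ * Real.log (y / T)) + T ^ (-δ) * (δ * (-1 / T)) =
      psiW' δ y T := by
    rw [psiW', hT1]; field_simp; ring
  rw [← heq]
  exact h

/-- `−ψ'(T) ≥ 0` for `0 < T ≤ y`, `δ ≥ 0`. [folklore] -/
theorem neg_psiW'_nonneg {δ y T : ℝ} (hδ : 0 ≤ δ) (hT : 0 < T) (hTy : T ≤ y) :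
    0 ≤ -psiW' δ y T := by
  have hlog : 0 ≤ Real.log (y / T) := Real.log_nonneg ((one_le_div hT).2 hTy)
  have : 0 ≤ δ * T ^ (-1 - δ) * (2 + δ * Real.log (y / T)) := by positivity
  simp only [psiW']; linarith

/-- Continuity of `T ↦ log(y/T)` on `(0, ∞)` (`y > 0`). [folklore] -/
theorem continuousOn_log_div {y : ℝ} (hy : 0 < y) :
    ContinuousOn (fun T : ℝ => Real.log (y / T)) (Set.Ioi 0) := by
  refine ContinuousOn.log (continuousOn_const.div continuousOn_id fun T hT => ne_of_gt hT) ?_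
  intro T hT
  exact (div_pos hy hT).ne'

/-- Continuity of `ψ'` on `(0, ∞)`. [folklore] -/
theorem continuousOn_psiW' (δ : ℝ) {y : ℝ} (hy : 0 < y) : ContinuousOn (psiW' δ y) (Set.Ioi 0) := by
  refine ContinuousOn.mul (ContinuousOn.mul continuousOn_const ?_) ?_
  · exact continuousOn_id.rpow_const fun T hT => Or.inl (ne_of_gt hT)
  · exact continuousOn_const.add (continuousOn_const.mul (continuousOn_log_div hy))

/-- Continuity of `ψ` on `(0, ∞)`. [folklore] -/
theorem continuousOn_psiW (δ : ℝ) {y : ℝ} (hy : 0 < y) : ContinuousOn (psiW δ y) (Set.Ioi 0) := by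
  refine ContinuousOn.mul ?_ ?_
  · exact continuousOn_id.rpow_const fun T hT => Or.inl (ne_of_gt hT)
  · exact continuousOn_const.add (continuousOn_const.mul (continuousOn_log_div hy))

/-! ### The antiderivative and the per-term identity -/

/-- `A_g(T) = −ψ(T) log(T/g) − T^{-δ} log(y/T)`, an antiderivative of `−ψ'(T) log(T/g)`. [folklore] -/
def antider (δ y g T : ℝ) : ℝ := -psiW δ y T * Real.log (T / g) - T ^ (-δ) * Real.log (y / T)

/-- `A_g' = −ψ' · log(T/g)` at `T > 0` (`y, g > 0`). [folklore] -/
theorem hasDerivAt_antider (δ : ℝ) {y g T : ℝ} (hy : 0 < y) (hg : 0 < g) (hT : 0 < T) :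
    HasDerivAt (antider δ y g) (-psiW' δ y T * Real.log (T / g)) T := by
  -- `d/dT log(T/g) = 1/T`
  have hl : HasDerivAt (fun T : ℝ => Real.log (T / g)) (1 / T) T := by
    have : HasDerivAt (fun T : ℝ => Real.log T - Real.log g) (T⁻¹ - 0) T :=
      (Real.hasDerivAt_log hT.ne').sub (hasDerivAt_const T _)
    have heq : (fun T : ℝ => Real.log (T / g)) =ᶠ[nhds T] fun T => Real.log T - Real.log g := by
      filter_upwards [lt_mem_nhds hT] with u hu
      rw [Real.log_div hu.ne' hg.ne']
    rw [show (1 / T : ℝ) = T⁻¹ - 0 by ring]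
    exact this.congr_of_eventuallyEq heq
  have h1 : HasDerivAt (fun T => -psiW δ y T * Real.log (T / g))
      (-psiW' δ y T * Real.log (T / g) + -psiW δ y T * (1 / T)) T :=
    ((hasDerivAt_psiW δ hy hT).neg).mul hl
  have h2 : HasDerivAt (fun T : ℝ => T ^ (-δ) * Real.log (y / T))
      (-δ * T ^ (-1 - δ) * Real.log (y / T) + T ^ (-δ) * (-1 / T)) T :=
    (hasDerivAt_rpow_neg' δ hT).mul (hasDerivAt_log_div hy hT)
  have h := h1.sub h2
  have hT1 : T ^ (-δ) = T ^ (-1 - δ) * T := by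
    rw [show (-δ : ℝ) = (-1 - δ) + 1 by ring, Real.rpow_add hT, Real.rpow_one]
  have heq : -psiW' δ y T * Real.log (T / g) + -psiW δ y T * (1 / T) -
      (-δ * T ^ (-1 - δ) * Real.log (y / T) + T ^ (-δ) * (-1 / T)) =
      -psiW' δ y T * Real.log (T / g) := by
    simp only [psiW]; rw [hT1]; field_simp; ring
  rw [← heq]
  exact h

/-- **The per-term Abel identity**: for `0 < g ≤ y`,
`g^{-δ} log(y/g) = ψ(y) log(y/g) + ∫_g^y (−ψ'(T)) log(T/g) dT`. [folklore] -/
theorem rpow_mul_log_eq (δ : ℝ) {y g : ℝ} (hg : 0 < g) (hgy : g ≤ y) :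
    g ^ (-δ) * Real.log (y / g) =
      psiW δ y y * Real.log (y / g) + ∫ T in g..y, -psiW' δ y T * Real.log (T / g) := by
  have hy : 0 < y := lt_of_lt_of_le hg hgy
  have hderiv : ∀ T ∈ Set.uIcc g y, HasDerivAt (antider δ y g) (-psiW' δ y T * Real.log (T / g)) T := by
    intro T hT
    rw [Set.uIcc_of_le hgy] at hT
    exact hasDerivAt_antider δ hy hg (lt_of_lt_of_le hg hT.1)
  have hcont : ContinuousOn (fun T => -psiW' δ y T * Real.log (T / g)) (Set.uIcc g y) := by
    rw [Set.uIcc_of_le hgy]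
    have hsub : Set.Icc g y ⊆ Set.Ioi 0 := fun T hT => lt_of_lt_of_le hg hT.1
    refine ContinuousOn.mul ((continuousOn_psiW' δ hy).mono hsub).neg ?_
    refine ContinuousOn.log (continuousOn_id.div continuousOn_const fun _ _ => hg.ne') ?_
    intro T hT; exact (div_pos (lt_of_lt_of_le hg hT.1) hg).ne'
  have hint : IntervalIntegrable (fun T => -psiW' δ y T * Real.log (T / g)) volume g y :=
    hcont.intervalIntegrable
  rw [integral_eq_sub_of_hasDerivAt hderiv hint]
  simp only [antider, div_self hg.ne', div_self hy.ne', Real.log_one, mul_zero, sub_zero,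
    zero_sub, psiW_self δ hy]
  ring

/-! ### The main bound -/

/-- The summand with the `max`: `log(max(T,g)/g)` is `log(T/g)` for `T ≥ g` and `0` for `T ≤ g`,
and is continuous in `T`. [folklore] -/
theorem log_max_div_of_le {T g : ℝ} (h : g ≤ T) : Real.log (max T g / g) = Real.log (T / g) := by
  rw [max_eq_left h]

/-- `log(max(T,g)/g) = 0` for `T ≤ g`, `g > 0`. [folklore] -/
theorem log_max_div_of_ge {T g : ℝ} (hg : 0 < g) (h : T ≤ g) : Real.log (max T g / g) = 0 := by
  rw [max_eq_right h, div_self hg.ne', Real.log_one]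

/-- **Twisted coprime Möbius log sum.** For `q ≥ 1`, `δ ≥ 0` and `y ≥ 1`:
`|Σ_{g ≤ y, (g,q)=1} μ(g)/g · g^{-δ} · log(y/g)| ≤ (q/φ(q) + 6)(1 + δ log y)`
(Abel summation of the tree's bound for `δ = 0`, Graham's Lemma 2). [folklore] -/
theorem abs_sum_coprime_moebius_rpow_log_le {q : ℕ} (hq : q ≠ 0) {δ : ℝ} (hδ : 0 ≤ δ) {y : ℝ}
    (hy : 1 ≤ y) :
    |∑ g ∈ (Finset.Icc 1 ⌊y⌋₊).filter (fun g => g.Coprime q),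
        ((μ g : ℤ) : ℝ) / g * (g : ℝ) ^ (-δ) * Real.log (y / g)| ≤
      ((q : ℝ) / q.totient + 6) * (1 + δ * Real.log y) := by
  have hy0 : 0 < y := by linarith
  set C : ℝ := (q : ℝ) / q.totient + 6 with hC
  have hC0 : 0 ≤ C := by positivity
  have hM : ∀ T : ℝ, |∑ g ∈ (Finset.Icc 1 ⌊T⌋₊).filter (fun g => g.Coprime q),
      ((μ g : ℤ) : ℝ) / g * Real.log (T / g)| ≤ C := fun T =>
    abs_sum_coprime_moebius_div_mul_log_le hq T
  set F : Finset ℕ := (Finset.Icc 1 ⌊y⌋₊).filter (fun g => g.Coprime q) with hF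
  have hFg : ∀ g ∈ F, (0 : ℝ) < g ∧ (g : ℝ) ≤ y := by
    intro g hg
    simp only [hF, Finset.mem_filter, Finset.mem_Icc] at hg
    exact ⟨by exact_mod_cast hg.1.1, (Nat.floor_le hy0.le).trans' (by exact_mod_cast hg.1.2)⟩
  set f : ℝ → ℝ := fun T => -psiW' δ y T with hf
  -- the per-term identity, multiplied by `μ(g)/g` and summed
  have hterm : ∀ g ∈ F, ((μ g : ℤ) : ℝ) / g * (g : ℝ) ^ (-δ) * Real.log (y / g) =
      ((μ g : ℤ) : ℝ) / g * (psiW δ y y * Real.log (y / g)) +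
        ((μ g : ℤ) : ℝ) / g * ∫ T in (1 : ℝ)..y, f T * Real.log (max T g / g) := by
    intro g hg
    obtain ⟨hg0, hgy⟩ := hFg g hg
    have hg1 : (1 : ℝ) ≤ g := by
      simp only [hF, Finset.mem_filter, Finset.mem_Icc] at hg; exact_mod_cast hg.1.1
    -- `∫_1^y f log(max(T,g)/g) = ∫_g^y f log(T/g)`
    have hcontF : ContinuousOn (fun T => f T * Real.log (max T g / g)) (Set.Ioi 0) := by
      refine ((continuousOn_psiW' δ hy0).neg).mul ?_
      refine ContinuousOn.log ((continuous_id.max continuous_const).continuousOn.div continuousOn_const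
        fun _ _ => hg0.ne') ?_
      intro T _; exact (div_pos (lt_of_lt_of_le hg0 (le_max_right T g)) hg0).ne'
    have hi1 : IntervalIntegrable (fun T => f T * Real.log (max T g / g)) volume 1 g :=
      (hcontF.mono (by rw [Set.uIcc_of_le hg1]; exact fun T hT => lt_of_lt_of_le one_pos hT.1)).intervalIntegrable
    have hi2 : IntervalIntegrable (fun T => f T * Real.log (max T g / g)) volume g y :=
      (hcontF.mono (by rw [Set.uIcc_of_le hgy]; exact fun T hT => lt_of_lt_of_le hg0 hT.1)).intervalIntegrable
    have hsplit := integral_add_adjacent_intervals hi1 hi2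
    have hzero : ∫ T in (1 : ℝ)..g, f T * Real.log (max T g / g) = 0 := by
      rw [integral_of_le hg1]
      refine setIntegral_eq_zero_of_forall_eq_zero fun T hT => ?_
      rw [log_max_div_of_ge hg0 hT.2, mul_zero]
    have hright : ∫ T in (g : ℝ)..y, f T * Real.log (max T g / g) =
        ∫ T in (g : ℝ)..y, f T * Real.log (T / g) := by
      refine integral_congr fun T hT => ?_
      rw [Set.uIcc_of_le hgy] at hT
      rw [log_max_div_of_le hT.1]
    have hI : ∫ T in (1 : ℝ)..y, f T * Real.log (max T g / g) =
        ∫ T in (g : ℝ)..y, f T * Real.log (T / g) := by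
      rw [← hsplit, hzero, zero_add, hright]
    rw [hI, mul_assoc, rpow_mul_log_eq δ hg0 hgy]
    ring
  rw [sum_congr rfl hterm, sum_add_distrib]
  -- the first piece: `ψ(y) M(y)`
  have h1 : |∑ g ∈ F, ((μ g : ℤ) : ℝ) / g * (psiW δ y y * Real.log (y / g))| ≤ psiW δ y y * C := by
    have : ∑ g ∈ F, ((μ g : ℤ) : ℝ) / g * (psiW δ y y * Real.log (y / g)) =
        psiW δ y y * ∑ g ∈ F, ((μ g : ℤ) : ℝ) / g * Real.log (y / g) := by
      rw [mul_sum]; exact sum_congr rfl fun g _ => by ring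
    rw [this, abs_mul, abs_of_nonneg (psiW_self_nonneg δ hy0)]
    exact mul_le_mul_of_nonneg_left (hM y) (psiW_self_nonneg δ hy0)
  -- the second piece: swap sum and integral, then bound by `C ∫ f = C (ψ(1) − ψ(y))`
  have hcontg : ∀ g ∈ F, ContinuousOn (fun T => ((μ g : ℤ) : ℝ) / g *
      (f T * Real.log (max T g / g))) (Set.uIcc 1 y) := by
    intro g hg
    obtain ⟨hg0, _⟩ := hFg g hg
    rw [Set.uIcc_of_le hy]
    refine continuousOn_const.mul ?_
    refine (((continuousOn_psiW' δ hy0).neg).mul ?_).mono fun T hT => lt_of_lt_of_le one_pos hT.1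
    refine ContinuousOn.log ((continuous_id.max continuous_const).continuousOn.div continuousOn_const
      fun _ _ => hg0.ne') ?_
    intro T _; exact (div_pos (lt_of_lt_of_le hg0 (le_max_right T g)) hg0).ne'
  have hswap : ∑ g ∈ F, ((μ g : ℤ) : ℝ) / g * ∫ T in (1 : ℝ)..y, f T * Real.log (max T g / g) =
      ∫ T in (1 : ℝ)..y, f T * ∑ g ∈ F, ((μ g : ℤ) : ℝ) / g * Real.log (max T g / g) := by
    have : ∀ g ∈ F, ((μ g : ℤ) : ℝ) / g * ∫ T in (1 : ℝ)..y, f T * Real.log (max T g / g) =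
        ∫ T in (1 : ℝ)..y, ((μ g : ℤ) : ℝ) / g * (f T * Real.log (max T g / g)) := by
      intro g _; rw [intervalIntegral.integral_const_mul]
    rw [sum_congr rfl this, ← intervalIntegral.integral_finsetSum fun g hg => (hcontg g hg).intervalIntegrable]
    refine integral_congr fun T _ => ?_
    rw [mul_sum]
    exact sum_congr rfl fun g _ => by ring
  -- pointwise: the inner sum is the untwisted sum at `T`
  have hinner : ∀ T ∈ Set.Icc (1 : ℝ) y, ∑ g ∈ F, ((μ g : ℤ) : ℝ) / g * Real.log (max T g / g) =
      ∑ g ∈ (Finset.Icc 1 ⌊T⌋₊).filter (fun g => g.Coprime q), ((μ g : ℤ) : ℝ) / g * Real.log (T / g) := by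
    intro T hT
    have hT0 : 0 ≤ T := by linarith [hT.1]
    have hsub : (Finset.Icc 1 ⌊T⌋₊).filter (fun g => g.Coprime q) ⊆ F := by
      intro g hg
      simp only [hF, Finset.mem_filter, Finset.mem_Icc] at hg ⊢
      exact ⟨⟨hg.1.1, hg.1.2.trans (Nat.floor_mono hT.2)⟩, hg.2⟩
    rw [← sum_subset hsub]
    · refine sum_congr rfl fun g hg => ?_
      simp only [Finset.mem_filter, Finset.mem_Icc] at hg
      have hgT : (g : ℝ) ≤ T := (Nat.floor_le hT0).trans' (by exact_mod_cast hg.1.2)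
      rw [log_max_div_of_le hgT]
    · intro g hgF hgn
      obtain ⟨hg0, _⟩ := hFg g hgF
      have hTg : T ≤ g := by
        by_contra h
        push Not at h
        apply hgn
        simp only [hF, Finset.mem_filter, Finset.mem_Icc] at hgF ⊢
        exact ⟨⟨hgF.1.1, Nat.le_floor h.le⟩, hgF.2⟩
      rw [log_max_div_of_ge hg0 hTg, mul_zero]
  have h2 : |∫ T in (1 : ℝ)..y, f T * ∑ g ∈ F, ((μ g : ℤ) : ℝ) / g * Real.log (max T g / g)| ≤
      C * (psiW δ y 1 - psiW δ y y) := by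
    have hfint : ∫ T in (1 : ℝ)..y, f T = psiW δ y 1 - psiW δ y y := by
      have hderiv : ∀ T ∈ Set.uIcc 1 y, HasDerivAt (fun T => -psiW δ y T) (f T) T := by
        intro T hT
        rw [Set.uIcc_of_le hy] at hT
        exact (hasDerivAt_psiW δ hy0 (lt_of_lt_of_le one_pos hT.1)).neg
      have hfi : IntervalIntegrable f volume 1 y := by
        refine ContinuousOn.intervalIntegrable ?_
        rw [Set.uIcc_of_le hy]
        exact ((continuousOn_psiW' δ hy0).neg).mono fun T hT => lt_of_lt_of_le one_pos hT.1
      rw [integral_eq_sub_of_hasDerivAt hderiv hfi]; ring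
    have hle : ∀ T ∈ Set.Icc (1 : ℝ) y, |f T * ∑ g ∈ F, ((μ g : ℤ) : ℝ) / g * Real.log (max T g / g)| ≤
        C * f T := by
      intro T hT
      have hf0 : 0 ≤ f T := neg_psiW'_nonneg hδ (lt_of_lt_of_le one_pos hT.1) hT.2
      rw [hinner T hT, abs_mul, abs_of_nonneg hf0, mul_comm]
      exact mul_le_mul_of_nonneg_right (hM T) hf0
    calc |∫ T in (1 : ℝ)..y, f T * ∑ g ∈ F, ((μ g : ℤ) : ℝ) / g * Real.log (max T g / g)|
        ≤ ∫ T in (1 : ℝ)..y, C * f T := by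
          rw [← Real.norm_eq_abs]
          refine norm_integral_le_of_norm_le hy ?_ ?_
          · exact ae_of_all _ fun T hT => by
              rw [Real.norm_eq_abs]; exact hle T ⟨hT.1.le, hT.2⟩
          · refine (continuousOn_const.mul ?_).intervalIntegrable
            rw [Set.uIcc_of_le hy]
            exact ((continuousOn_psiW' δ hy0).neg).mono fun T hT => lt_of_lt_of_le one_pos hT.1
      _ = C * (psiW δ y 1 - psiW δ y y) := by rw [intervalIntegral.integral_const_mul, hfint]
  rw [hswap]
  calc |∑ g ∈ F, ((μ g : ℤ) : ℝ) / g * (psiW δ y y * Real.log (y / g)) +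
        ∫ T in (1 : ℝ)..y, f T * ∑ g ∈ F, ((μ g : ℤ) : ℝ) / g * Real.log (max T g / g)|
      ≤ psiW δ y y * C + C * (psiW δ y 1 - psiW δ y y) := (abs_add_le _ _).trans (add_le_add h1 h2)
    _ = C * psiW δ y 1 := by ring
    _ = ((q : ℝ) / q.totient + 6) * (1 + δ * Real.log y) := by rw [hC, psiW_one]

end Literature.NumberTheory.Sieve.CoprimeMoebius
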